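/-
Copyright: public-domain mathematics; typed transcription for the H21 Literature library (cell lit-balaban,
reader/typer seat r02 gen 5 = literature-prover-lit-balaban-r02-g5-0).

statement-level skeleton of published theorems with citation tags; proofs where landed; nothing here is a claim about the Yang–Mills mass gap

# Bałaban, *Propagators and renormalization transformations for lattice gauge theories. I*,
# Commun. Math. Phys. **95** (1984) 17–40 — the unit-lattice row sums «Σ_{y′} e^{−δ₀|y−y′|}» behind (1.115)–(1.117) /
# (1.131) / (1.133), UNIFORM IN THE TORUS, for the setting of record `latticeSettingP12 n M a k`

[cite: Balaban1984PropagatorsI]  T. Bałaban, Commun. Math. Phys. 95 (1984) 17–40, p. 36 (PDF p. 20), verbatim (OCR layer of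
the held scan `paper:balaban1984-cmp95-propagators-rt-i` p0020.txt, checked against the b2b render p020): «The localized
inequalities (1.110)–(1.114) imply immediately the following global inequalities |GJ|, |∇GJ|, |G∇*J|, |ΔGJ|, ‖∇GJ‖_α,
‖G∇*J‖_α ≤ O(1)|J|, (1.115) … with the same dependence of the constants O(1).»; p. 35: «two families of cubes, both
parametrized by points of the unit lattice T₁^{(k)}»; p. 38 (1.131) / p. 39 (1.133): the sums over `y′ ∈ T₁^{(k)}` of
`e^{−δ₀|y−y′|}`-weighted terms.  The word «immediately» = the summation over `y′` with `Σ_{y′∈T₁^{(k)}} e^{−δ₀|y−y′|} ≤ Λ(δ₀, d)`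
bounded uniformly in the torus — the hypothesis `hRow` of the tree's `B5Global115.global_of_prop12` / `S2_via132` /
`global_via132_walk` and the field `hdist` of `B5Local114.Realisation`.

WHAT THIS MODULE ADDS (SKELETON rows B5.Eq1.117 / B5.Prop1.2, owner's census; companion of `B5Prop12FieldsLattice`,
`B5Ineq110P12Lattice`).  For the SETTING OF RECORD `B5Prop12FieldsLattice.latticeSettingP12 n M a k` (sites = the unit-lattice
torus `Tor M = Π_μ ℤ/M_μ`, `dist = distSite M` the sup circular distance) we DISCHARGE these located leaves from the tree's
torus toolkit `B5TorusCover` (pre-cell b2b-balaban lineage) BY NAME: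
* `chartSite`/`chartP12`: the unit-lattice torus of the setting IS a `B5TorusCover.Chart` of dimension `d` — the identity
  coordinates `ZMod (M μ) → Fin (M μ)`, with `tdist M (chart y) (chart y′) = distSite M y y′` EXACTLY (`tdist_chartSite`);
* `rowSum_distSite_le`: `Σ_{y′∈T} e^{−κ·distSite y y′} ≤ K_d(κ) = B4Sect5Proof.latticeConst d κ` for every finite `T`, every
  `κ > 0`, every `y`, uniformly in the periods `M`;
* `hRow_latticeSettingP12`: the family hypothesis `hRow` of `B5Global115.global_of_prop12` in its literal binder shape, for
  every family `i ↦ latticeSettingP12 (n i) (M i) (a i) (k i)` of tori of one dimension `d` and ANY finite sets `T i`;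
* `hdist_latticeSettingP12`: the field `hdist` of `B5Local114.Realisation` for the setting (with `X := B5TorusCover.UT M`,
  `site := UT.ofSite M ∘ chartSite M`), an equality in fact;
* `ballCard_distSite_le`: `#{y′ : |y − y′| ≤ r} ≤ (2⌊r⌋ + 1)^d`.

HONEST SCOPE.  Pure bookkeeping (no operator enters): the only content is that the setting's abstract `Site`/`dist` are a
concrete torus with its sup distance, so that the tree's uniform torus sums apply.  Constants `K_d(κ)` ours.  Nothing of
B5 is used as a hypothesis.
-/
import Mathlib
import Literature.MathematicalPhysics.QuantumFieldTheory.Balaban1983to89.B5Ineq110P12Lattice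
import Literature.MathematicalPhysics.QuantumFieldTheory.Balaban1983to89.B5TorusCover

open scoped BigOperators Real
open Finset

namespace Literature.MathematicalPhysics.QuantumFieldTheory.Balaban1983to89.B5RowSumsP12Lattice

open Literature.MathematicalPhysics.QuantumFieldTheory.Balaban1983to89
open Literature.MathematicalPhysics.QuantumFieldTheory.Balaban1983to89.B5Prop11Plancherel (Tor fine)
open Literature.MathematicalPhysics.QuantumFieldTheory.Balaban1983to89.B5Prop12FieldsLattice
open Literature.MathematicalPhysics.QuantumFieldTheory.Balaban1983to89.B4TorusKernel.MultiPeriod (circAbs circAbs_nonneg)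
open Literature.MathematicalPhysics.QuantumFieldTheory.Balaban1983to89.B4Sect5Torus (TSite ccoord tdist ccoord_cast)
open Literature.MathematicalPhysics.QuantumFieldTheory.Balaban1983to89.B4Sect5Proof (latticeConst)
open Literature.MathematicalPhysics.QuantumFieldTheory.Balaban1983to89.B6Cov2156Torus (one_le_M)
open Literature.MathematicalPhysics.QuantumFieldTheory.Balaban1983to89.B5TorusCover (Chart rowSum_chart_le hRow_of_charts
  ballCard_chart_le hdist_holds UT)
open Literature.MathematicalPhysics.QuantumFieldTheory.Balaban1983to89.B5Ineq110P12Lattice (natAbs_valMinAbs_intCast_sub)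

noncomputable section

variable {d : ℕ} (M : Fin d → ℕ) [hM : ∀ μ, NeZero (M μ)]

/-! ## §1 The unit-lattice torus of the setting as a `B5TorusCover.Chart` -/

/-- the identity coordinates of the unit-lattice torus: `y ↦ (rep y_μ)_μ ∈ Π_μ Fin (M μ)`.
[cite: Balaban1984PropagatorsI, p.35 («points of the unit lattice T₁^{(k)}»)] -/
def chartSite (y : Tor M) : TSite d M := fun μ => ⟨(y μ).val, ZMod.val_lt (y μ)⟩

/-- the coordinates are the residues' representatives. [cite: Balaban1984PropagatorsI, p.35 (T₁^{(k)})] -/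
@[simp] theorem chartSite_apply_val (y : Tor M) (μ : Fin d) : (chartSite M y μ).val = (y μ).val := rfl

/-- the coordinate map is injective. [cite: Balaban1984PropagatorsI, p.35 (T₁^{(k)})] -/
theorem chartSite_injective : Function.Injective (chartSite M) := by
  intro y y' h
  funext μ
  have hμ : (y μ).val = (y' μ).val := by
    have := congr_arg (fun f : TSite d M => (f μ).val) h
    simpa using this
  exact ZMod.val_injective _ hμ

/-- coordinatewise, the chart's circular coordinate distance IS the setting's: `ccoord M (chart y) (chart y′) μ =
|(y − y′)_μ|_{ℤ/M_μ}`. [cite: Balaban1984PropagatorsI, Prop. 1.2 (1.110) p.35 (the distance |y − y′|)] -/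
theorem ccoord_chartSite (y y' : Tor M) (μ : Fin d) :
    ccoord M (chartSite M y) (chartSite M y') μ = ((y μ - y' μ).valMinAbs).natAbs := by
  have h1 : ((ccoord M (chartSite M y) (chartSite M y') μ : ℕ) : ℤ)
      = circAbs (M μ) ((((y μ).val : ℕ) : ℤ) - (((y' μ).val : ℕ) : ℤ)) :=
    ccoord_cast (fun i => one_le_M M i) _ _ μ
  have h2 : ((((y μ - y' μ).valMinAbs).natAbs : ℕ) : ℤ)
      = circAbs (M μ) ((((y μ).val : ℕ) : ℤ) - (((y' μ).val : ℕ) : ℤ)) := by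
    have h := natAbs_valMinAbs_intCast_sub (N := M μ) (((y μ).val : ℕ) : ℤ) (((y' μ).val : ℕ) : ℤ)
    simp only [Int.cast_natCast, ZMod.natCast_zmod_val] at h
    exact h
  exact_mod_cast h1.trans h2.symm

/-- **the chart is isometric**: `tdist M (chart y) (chart y′) = distSite M y y′`.
[cite: Balaban1984PropagatorsI, Prop. 1.2 (1.110) p.35 (the distance |y − y′|)] -/
theorem tdist_chartSite (y y' : Tor M) : tdist M (chartSite M y) (chartSite M y') = distSite M y y' := by
  unfold tdist distSite
  have h : Finset.univ.sup (ccoord M (chartSite M y) (chartSite M y'))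
      = Finset.univ.sup fun μ => ((y μ - y' μ).valMinAbs).natAbs :=
    Finset.sup_congr rfl fun μ _ => ccoord_chartSite M y y' μ
  rw [h]

/-- **THE UNIT-LATTICE TORUS OF THE SETTING OF RECORD IS A `Chart` OF DIMENSION `d`** (identity coordinates, exact
distances). [cite: Balaban1984PropagatorsI, p.35 (T₁^{(k)}), (1.115)–(1.117) p.36] -/
def chartP12 : Chart (Tor M) (distSite M) d where
  N := M
  hN := fun i => one_le_M M i
  e := chartSite M
  inj := chartSite_injective M
  le := fun y y' => (tdist_chartSite M y y').le

/-- the same chart, typed over the setting's own fields `(latticeSettingP12 n M a k).Site` / `.dist` (which ARE `Tor M` /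
`distSite M`). [cite: Balaban1984PropagatorsI, (1.115)–(1.117) p.36] -/
def chartLatticeSettingP12 (n : ℕ) [NeZero n] (a : ℝ) (k : ℕ) :
    Chart (latticeSettingP12 n M a k).Site (latticeSettingP12 n M a k).dist d :=
  chartP12 M

/-! ## §2 Row sums, ball counts, and the hypotheses `hRow` / `hdist` of the tree's assembly theorems -/

/-- **UNIT-LATTICE ROW SUMS, UNIFORM IN THE TORUS**: `Σ_{y′∈T} e^{−κ|y−y′|} ≤ K_d(κ)` for every finite set `T` of
unit-lattice points, every `κ > 0`, every `y`, every period vector `M` (`K_d = B4Sect5Proof.latticeConst d`, the tree's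
`B4Sect5Torus.torusSum_le` through the chart). [cite: Balaban1984PropagatorsI, (1.115)–(1.117) p.36 («imply immediately»: the summation over y′)] -/
theorem rowSum_distSite_le {κ : ℝ} (hκ : 0 < κ) (T : Finset (Tor M)) (y : Tor M) :
    ∑ y' ∈ T, Real.exp (-(κ * distSite M y y')) ≤ latticeConst d κ :=
  rowSum_chart_le (chartP12 M) hκ T y

/-- the full row sum over the whole unit-lattice torus. [cite: Balaban1984PropagatorsI, (1.115)–(1.117) p.36, (1.131) p.38] -/
theorem rowSum_univ_distSite_le {κ : ℝ} (hκ : 0 < κ) (y : Tor M) :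
    ∑ y' : Tor M, Real.exp (-(κ * distSite M y y')) ≤ latticeConst d κ :=
  rowSum_distSite_le M hκ Finset.univ y

/-- **BALL COUNTS**: `#{y′ ∈ T₁ : |y − y′| ≤ r} ≤ (2⌊r⌋ + 1)^d`, uniformly in the torus.
[cite: Balaban1984PropagatorsI, p.36 (the cubes parametrized by T₁^{(k)})] -/
theorem ballCard_distSite_le (y : Tor M) {r : ℝ} (hr : 0 ≤ r) :
    ((Finset.univ.filter fun w : Tor M => distSite M y w ≤ r).card : ℝ) ≤ (2 * ⌊r⌋₊ + 1 : ℝ) ^ d :=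
  ballCard_chart_le (chartP12 M) y hr

/-- **THE HYPOTHESIS `hRow` OF `B5Global115.global_of_prop12` (and of `S2_via132` / `global_via132_walk`) DISCHARGED FOR
FAMILIES OF THE SETTING OF RECORD**, in its literal binder shape: for every family `i ↦ latticeSettingP12 (n i) (M i) (a i) (k i)`
of tori of one dimension `d` and ANY finite sets `T i` of sites (there: the index sets `(D i).T1` of the covers),
`∀ κ > 0, ∃ Λ, ∀ i y, Σ_{y′∈T i} e^{−κ·dist y y′} ≤ Λ` (`Λ = K_d(κ)`).
[cite: Balaban1984PropagatorsI, (1.115)–(1.117) p.36] -/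
theorem hRow_latticeSettingP12 {I : Type*} (k : I → ℕ) (n : I → ℕ) [∀ i, NeZero (n i)] (M : I → Fin d → ℕ)
    [∀ i μ, NeZero (M i μ)] (a : I → ℝ) (T : ∀ i, Finset (latticeSettingP12 (n i) (M i) (a i) (k i)).Site) :
    ∀ κ : ℝ, 0 < κ → ∃ Λ : ℝ, ∀ (i : I) (y : (latticeSettingP12 (n i) (M i) (a i) (k i)).Site),
      ∑ y' ∈ T i, Real.exp (-(κ * (latticeSettingP12 (n i) (M i) (a i) (k i)).dist y y')) ≤ Λ :=
  hRow_of_charts (fam := fun i => latticeSettingP12 (n i) (M i) (a i) (k i)) (fun i => chartP12 (M i)) T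

/-- the same with the explicit uniform bound `Λ = K_d(κ)`. [cite: Balaban1984PropagatorsI, (1.115)–(1.117) p.36] -/
theorem rowSum_latticeSettingP12_le (n : ℕ) [NeZero n] (a : ℝ) (k : ℕ) {κ : ℝ} (hκ : 0 < κ)
    (T : Finset (latticeSettingP12 n M a k).Site) (y : (latticeSettingP12 n M a k).Site) :
    ∑ y' ∈ T, Real.exp (-(κ * (latticeSettingP12 n M a k).dist y y')) ≤ latticeConst d κ :=
  rowSum_chart_le (chartLatticeSettingP12 M n a k) hκ T y

/-- **THE FIELD `hdist` OF `B5Local114.Realisation` FOR THE SETTING OF RECORD** with `X := B5TorusCover.UT M` (the unit torus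
as a pseudometric space) and `site := UT.ofSite M ∘ chartSite M`: `dist y y′ ≤ dist (site y) (site y′)` (an equality).
[cite: Balaban1984PropagatorsI, p.36 (the random walk expansion lives on T₁^{(k)})] -/
theorem hdist_latticeSettingP12 (n : ℕ) [NeZero n] (a : ℝ) (k : ℕ) :
    ∀ y y' : (latticeSettingP12 n M a k).Site,
      (latticeSettingP12 n M a k).dist y y' ≤ dist (UT.ofSite M (chartSite M y)) (UT.ofSite M (chartSite M y')) :=
  hdist_holds (St := latticeSettingP12 n M a k) M (chartSite M) fun y y' => (tdist_chartSite M y y').symm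

/-- `distSite` is symmetric (through the chart). [cite: Balaban1984PropagatorsI, Prop. 1.2 (1.110) p.35 (|y − y′|)] -/
theorem distSite_comm (y y' : Tor M) : distSite M y y' = distSite M y' y := by
  rw [← tdist_chartSite, ← tdist_chartSite, B4Sect5Torus.tdist_symm (fun i => one_le_M M i)]

/-- `distSite` satisfies the triangle inequality (through the chart). [cite: Balaban1984PropagatorsI, Prop. 1.2 (1.110) p.35 (|y − y′|)] -/
theorem distSite_triangle (y w y' : Tor M) : distSite M y y' ≤ distSite M y w + distSite M w y' := by
  rw [← tdist_chartSite, ← tdist_chartSite, ← tdist_chartSite]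
  exact B4Sect5Torus.tdist_triangle (fun i => one_le_M M i) _ _ _

end

end Literature.MathematicalPhysics.QuantumFieldTheory.Balaban1983to89.B5RowSumsP12Lattice
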